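import Mathlib.Algebra.Homology.ConcreteCategory
import Literature.AlgebraicTopology.SingularHomology.CohomologyBockstein
import Literature.AlgebraicTopology.SingularHomology.CupProduct
import HarnessLib

/-!
# Bockstein homomorphisms on representing cocycles

A. Hatcher, *Algebraic Topology* (2002), §3.E p. 303 with §2.1 p. 116 (the definition of a
connecting homomorphism): for a short exact sequence of coefficient modules
`0 → M →ᶠ N →ᵍ P → 0`, the Bockstein `β : Hⁿ(X; P) → Hⁿ⁺¹(X; M)` of a class `[z]` is computed by
lifting the cocycle `z` to a cochain `y ∈ Cⁿ(X; N)` (`g ∘ y = z`), whose coboundary `δy` has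
values in `ker g = im f`, `δy = f ∘ x`, and `β[z] = [x]`. For the integral Bockstein `β̃ₘ` of
`0 → ℤ →ᵐ ℤ → ℤ/m → 0`: lift `z ∈ Zⁿ(X; ℤ/m)` to an integral cochain `y`, write `δy = m x`, then
`β̃ₘ[z] = [x] ∈ Hⁿ⁺¹(X; ℤ)` ("`β̃` is `1/m` times the coboundary of an integral lift").

The tree's `cohomologyBockstein` / `integralBockstein` (`CohomologyBockstein.lean`) are
Mathlib's abstract connecting homomorphisms `ShortComplex.ShortExact.δ`; this file PROVES the
representative-level formulas from Mathlib's `ShortComplex.ShortExact.δ_apply`: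

* `singularCochainComplex.cocyclesMapCoeff`, `singularCohomology.mapCoeff_π`: change of
  coefficients on representatives, `f_*[z] = [f ∘ z]` (in particular `reduceMod_π`);
* **`cohomologyBockstein_π`**: `β[z] = [x]` whenever `g ∘ y = z` and `f ∘ x = δy`;
* **`integralBockstein_π`**: `β̃ₘ[z] = [x]` whenever `y mod m = z` and `m • x = δy`.

No definitions beyond the abbreviation `cocyclesMapCoeff`; no named facts.

## References

* A. Hatcher, *Algebraic Topology*, CUP 2002, §2.1 p. 116 (connecting homomorphism on
  representatives), §3.E p. 303 (Bockstein homomorphisms `β`, `β̃`). [HatcherAT2002]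
-/

noncomputable section

open CategoryTheory Limits

universe u v

namespace Literature.AlgebraicTopology.SingularHomology

variable {R : Type v} [CommRing R]
variable {M N P : Type v} [AddCommGroup M] [Module R M] [AddCommGroup N] [Module R N]
  [AddCommGroup P] [Module R P]
variable (X : Type u) [TopologicalSpace X] (f : M →ₗ[R] N) (g : N →ₗ[R] P) {n : ℕ}

namespace singularCochainComplex

/-! ### Change of coefficients on cocycles -/

/-- `f_♯ : Zⁿ(X; M) ⟶ Zⁿ(X; N)` on cocycles, `z ↦ f ∘ z` (Hatcher 2002, §3.1 p. 198);
`HomologicalComplex.cyclesMap` of `mapCoeff X f`. [cite: HatcherAT2002, §3.1 p. 198] -/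
abbrev cocyclesMapCoeff (n : ℕ) : cocycles R M X n ⟶ cocycles R N X n :=
  HomologicalComplex.cyclesMap (mapCoeff X f) n

/-- The cochain of `f_♯ z` is `f ∘ z`. [cite: HatcherAT2002, §3.1 p. 198] -/
@[simp]
lemma iCocycles_cocyclesMapCoeff (z : cocycles R M X n) :
    iCocycles R N X n (cocyclesMapCoeff X f n z) = (mapCoeff X f).f n (iCocycles R M X n z) := by
  change (cocyclesMapCoeff X f n ≫ iCocycles R N X n) z = (iCocycles R M X n ≫ (mapCoeff X f).f n) z
  rw [HomologicalComplex.cyclesMap_i]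

/-- Pointwise: `(f_♯ z)(σ) = f (z σ)`. [cite: HatcherAT2002, §3.1 p. 198] -/
lemma iCocycles_cocyclesMapCoeff_apply (z : cocycles R M X n) (σ : SingularSimplex X n) :
    iCocycles R N X n (cocyclesMapCoeff X f n z) σ = f (iCocycles R M X n z σ) := by
  rw [iCocycles_cocyclesMapCoeff]
  rfl

end singularCochainComplex

open singularCochainComplex

/-- **Change of coefficients on representatives**: `f_*[z] = [f ∘ z]` (Hatcher 2002, §3.1
p. 198); `HomologicalComplex.homologyπ_naturality`. [cite: HatcherAT2002, §3.1 p. 198] -/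
theorem singularCohomology.mapCoeff_π (z : cocycles R M X n) :
    singularCohomology.mapCoeff X f n (singularCohomology.π R M X n z) =
      singularCohomology.π R N X n (cocyclesMapCoeff X f n z) := by
  change ((singularCochainComplex R M X).homologyπ n ≫
      HomologicalComplex.homologyMap (singularCochainComplex.mapCoeff X f) n) z =
    (cocyclesMapCoeff X f n ≫ (singularCochainComplex R N X).homologyπ n) z
  rw [HomologicalComplex.homologyπ_naturality]

/-! ### The Bockstein on representatives -/

section Bockstein

variable (hfg : Function.Exact f g) (hf : Function.Injective f) (hg : Function.Surjective g)

omit hfg hg in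
include hf in
/-- If `f ∘ x = δy` with `f` injective then `δx = 0` (`f ∘ δx = δ(f ∘ x) = δδy = 0` and `f` is
injective on cochains). [cite: HatcherAT2002, §2.1 p. 116] -/
lemma d_eq_zero_of_comp_eq_d (y : SingularSimplex X n → N) (x : SingularSimplex X (n + 1) → M)
    (hx : ∀ τ, f (x τ) = (singularCochainComplex R N X).d n (n + 1) y τ) :
    (singularCochainComplex R M X).d (n + 1) (n + 1 + 1) x = 0 := by
  have hx' : (mapCoeff X f).f (n + 1) x = (singularCochainComplex R N X).d n (n + 1) y :=
    funext hx
  have h1 : (mapCoeff X f).f (n + 1 + 1) ((singularCochainComplex R M X).d (n + 1) (n + 1 + 1) x) =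
      (singularCochainComplex R N X).d (n + 1) (n + 1 + 1) ((mapCoeff X f).f (n + 1) x) := by
    rw [← ModuleCat.comp_apply, ← (mapCoeff X f).comm, ModuleCat.comp_apply]
  have h2 : (singularCochainComplex R N X).d (n + 1) (n + 1 + 1)
      ((singularCochainComplex R N X).d n (n + 1) y) = 0 := by
    rw [← ModuleCat.comp_apply, HomologicalComplex.d_comp_d]
    rfl
  refine singularCochainComplex.ext fun τ ↦ hf ?_
  calc f ((singularCochainComplex R M X).d (n + 1) (n + 1 + 1) x τ)
      = (mapCoeff X f).f (n + 1 + 1) ((singularCochainComplex R M X).d (n + 1) (n + 1 + 1) x) τ :=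
        rfl
    _ = (0 : SingularSimplex X (n + 1 + 1) → N) τ := by rw [h1, hx', h2]; rfl
    _ = f ((0 : SingularSimplex X (n + 1 + 1) → M) τ) := by rw [Pi.zero_apply, Pi.zero_apply, map_zero]

/-- **The Bockstein on representatives** (Hatcher 2002, §3.E p. 303 with §2.1 p. 116): for a
cocycle `z ∈ Zⁿ(X; P)`, any cochain `y ∈ Cⁿ(X; N)` lifting it (`g ∘ y = z`) and the cochain
`x ∈ Cⁿ⁺¹(X; M)` with `f ∘ x = δy` (which exists and is unique since `g ∘ δy = δz = 0` and
`ker g = im f`, `f` injective), `x` is a cocycle and `β[z] = [x]` in `Hⁿ⁺¹(X; M)`. From Mathlib's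
`ShortComplex.ShortExact.δ_apply`. [cite: HatcherAT2002, §3.E p. 303] -/
theorem cohomologyBockstein_π (z : cocycles R P X n) (y : SingularSimplex X n → N)
    (hy : ∀ σ, g (y σ) = iCocycles R P X n z σ) (x : SingularSimplex X (n + 1) → M)
    (hx : ∀ τ, f (x τ) = (singularCochainComplex R N X).d n (n + 1) y τ) :
    cohomologyBockstein X f g hfg hf hg n (singularCohomology.π R P X n z) =
      singularCohomology.π R M X (n + 1)
        (cocyclesMk x (d_eq_zero_of_comp_eq_d X f hf y x hx)) := by
  have hz : (singularCochainComplex R P X).d n (n + 1)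
      (iCocycles R P X n z : SingularSimplex X n → P) = 0 := d_iCocycles (n + 1) z
  have hy' : (mapCoeff X g).f n y = (iCocycles R P X n z : SingularSimplex X n → P) := funext hy
  have hx' : (mapCoeff X f).f (n + 1) x = (singularCochainComplex R N X).d n (n + 1) y :=
    funext hx
  have key : cohomologyBockstein X f g hfg hf hg n (singularCohomology.π R P X n
      ((singularCochainComplex R P X).cyclesMk (iCocycles R P X n z : SingularSimplex X n → P)
        (n + 1) (by simp) hz)) =
      singularCohomology.π R M X (n + 1) (cocyclesMk x (d_eq_zero_of_comp_eq_d X f hf y x hx)) :=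
    (shortExact_mapCoeffShortComplex X f g hfg hf hg).δ_apply n (n + 1) rfl
      (iCocycles R P X n z : SingularSimplex X n → P) hz y hy' x hx' (n + 1 + 1) (by simp)
  have ez : (singularCochainComplex R P X).cyclesMk
      (iCocycles R P X n z : SingularSimplex X n → P) (n + 1) (by simp) hz = z :=
    cocycles_ext ((singularCochainComplex R P X).i_cyclesMk _ (n + 1) (by simp) hz)
  rw [ez] at key
  exact key

end Bockstein

/-! ### Integral coefficients -/

section Integral

variable (m : ℕ) [NeZero m]

omit [NeZero m] in
/-- **Reduction mod `m` on representatives**: `ρₘ[w] = [w mod m]`. [cite: HatcherAT2002, §3.E p. 303] -/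
theorem reduceMod_π (w : cocycles ℤ ℤ X n) :
    reduceMod X m n (singularCohomology.π ℤ ℤ X n w) =
      singularCohomology.π ℤ (ZMod m) X n (cocyclesMapCoeff X (intCastZModLinearMap m) n w) :=
  singularCohomology.mapCoeff_π X _ w

omit [NeZero m] in
/-- The cochain of `w mod m` is `σ ↦ (w σ : ℤ/m)`. [cite: HatcherAT2002, §3.E p. 303] -/
lemma iCocycles_cocyclesMapCoeff_intCast_apply (w : cocycles ℤ ℤ X n) (σ : SingularSimplex X n) :
    iCocycles ℤ (ZMod m) X n (cocyclesMapCoeff X (intCastZModLinearMap m) n w) σ =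
      ((iCocycles ℤ ℤ X n w σ : ℤ) : ZMod m) :=
  iCocycles_cocyclesMapCoeff_apply X _ w σ

/-- If `m • x = δy` for integral cochains then `δx = 0` (integral cochains have no
`m`-torsion). [cite: HatcherAT2002, §3.E p. 303] -/
lemma d_eq_zero_of_smul_eq_d (y : SingularSimplex X n → ℤ) (x : SingularSimplex X (n + 1) → ℤ)
    (hx : ∀ τ, (m : ℤ) * x τ = (singularCochainComplex ℤ ℤ X).d n (n + 1) y τ) :
    (singularCochainComplex ℤ ℤ X).d (n + 1) (n + 1 + 1) x = 0 :=
  d_eq_zero_of_comp_eq_d X (LinearMap.lsmul ℤ ℤ m) (injective_lsmul m) y x hx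

/-- **The integral Bockstein on representatives** (Hatcher 2002, §3.E p. 303): for a cocycle
`z ∈ Zⁿ(X; ℤ/m)`, an integral cochain `y` with `y mod m = z` and the integral cochain `x` with
`m x = δy`, `β̃ₘ[z] = [x]` in `Hⁿ⁺¹(X; ℤ)`. [cite: HatcherAT2002, §3.E p. 303] -/
theorem integralBockstein_π (z : cocycles ℤ (ZMod m) X n) (y : SingularSimplex X n → ℤ)
    (hy : ∀ σ, ((y σ : ℤ) : ZMod m) = iCocycles ℤ (ZMod m) X n z σ)
    (x : SingularSimplex X (n + 1) → ℤ)
    (hx : ∀ τ, (m : ℤ) * x τ = (singularCochainComplex ℤ ℤ X).d n (n + 1) y τ) :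
    integralBockstein X m n (singularCohomology.π ℤ (ZMod m) X n z) =
      singularCohomology.π ℤ ℤ X (n + 1) (cocyclesMk x (d_eq_zero_of_smul_eq_d X m y x hx)) :=
  cohomologyBockstein_π X (LinearMap.lsmul ℤ ℤ m) (intCastZModLinearMap m) (exact_lsmul_intCast m)
    (injective_lsmul m) (surjective_intCast m) z y hy x hx

end Integral

end Literature.AlgebraicTopology.SingularHomology
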